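import Summits.PneNP.PneNP.Theorems.NegLimitedLoglogSlices
import Literature.Computability.Complexity.IndexAllBricks
import Literature.Computability.Complexity.UnaryBricks

/-!
# Route NegLimited, rung T4 (stmt-PneNP-19862) — the witness language and its decider

The witness of `NeglimitedNearMarkovNegations` is the language of strings `u` such that an ODD
number of the `K(|u|)` consecutive blocks of `u` of length `s(|u|)` lie in the Tardos witness
language `witnessLang F` of `NegLimitedLoglogSlices.lean` (`F` the tree's `ϑ`-routine), where

* `s(n) = nmBlockLen n = min (2^{32 ℓ(n)} - 1) n + 1`, `ℓ(n) = ⌊log₂ ⌊log₂ n⌋⌋` — at the designed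
  lengths `n = 2^a` this is `2^{32 ⌊log₂ a⌋} = m²` with `m = 2^{16 ⌊log₂ a⌋}` vertices per block;
* `K(n) = nmBlocks n = n / s(n)` — at `n = 2^a` this is `2^{a - 32 ⌊log₂ a⌋}`, i.e. EXACTLY
  `2^{budget}` for the item's NOT budget `⌊log₂ n⌋ - 32 ⌊log₂ ⌊log₂ n⌋⌋` (cell record
  HOME/pnp-ideate-p3/ROUND-4.md §7.5 and ERRATUM-P3-F5: the block count must be `2^{budget}`, not
  `2^{budget+1}`).

This file: the language (`nearMarkovLang F`), its membership in `P ⊆ NP` (`nearMarkovLang_mem_P`,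
`nearMarkovLang_mem_NP`) via a parity version `parityIdxFn` of the index-all loop
`Literature.Computability.Complexity.Brick.allIdxFn` (`IndexAllBricks.lean`: a counted `foldLoop`
XOR-ing one-bit answers), the parameter bricks `sFn`, `kFn`, `blkFn` in the `FP` string algebra,
and the slice of the language in terms of blocks (`sliceFn_nearMarkovLang`).

References: S. Arora, B. Barak, *Computational Complexity* (2009), §1.3 (polynomial time is
closed under composition and bounded loops), Claim 2.4 (`P ⊆ NP`) [AroraBarakCC2009];
S. Jukna, *Boolean Function Complexity* (2012), §10.5 Thm. 10.21 (the padded `2^r`-fold device)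
[Jukna2012].
-/

set_option linter.dupNamespace false

noncomputable section

namespace Summit.PneNP.PneNP.Theorems.NegLimNearMarkov

open Literature.Computability.Complexity Literature.Computability.Complexity.Brick
  Literature.Computability.Complexity.Plumb Literature.Computability.Complexity.HashBricks
  Summit.PneNP.PneNP.Theorems.NegLimSlices _root_.Computability Polynomial Finset

/-! ## A parity version of the index-all loop -/

/-- The one-bit exclusive or `⟨acc, b⟩ ↦ [acc.head ⊕ b.head]`. [folklore] -/
def xorOp : List Bool → List Bool :=
  xorFn (headBitFn ∘ fstF) (headBitFn ∘ sndF)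

/-- Value of `xorOp` on a pair of bits. [folklore] -/
@[simp] theorem xorOp_boolPair (b b' : Bool) : xorOp (boolPair [b] [b']) = [xor b b'] := by
  rw [xorOp, xorFn_apply (b := b) (b' := b')] <;> simp

/-- `xorOp ∈ FP`. [folklore] -/
theorem xorOp_mem_FP : xorOp ∈ FP :=
  xorFn_mem_FP (comp_mem_FP headBitFn_mem_FP fstF_mem_FP) (comp_mem_FP headBitFn_mem_FP sndF_mem_FP)

/-- `xorOp` is one-bit. [folklore] -/
theorem oneBit_xorOp : OneBit xorOp :=
  oneBit_xorFn (oneBit_headBitFn.comp fstF) (oneBit_headBitFn.comp sndF)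

/-- `xorOp` has one-symbol values (additive growth). [folklore] -/
theorem length_xorOp_le (w : List Bool) :
    (xorOp w).length ≤ (fstF w).length + (sndF w).length + 1 := by
  rw [oneBit_xorOp.length_eq]; omega

/-- **The XOR fold of a one-bit test**: from the accumulator `[b]`, `k` rounds from index `i₀`
give `[b ⊕ parity of #{i < k | c ⟨u, 1^{i₀+i}⟩ = [1]}]`. [folklore] -/
theorem foldAcc_xorOp {c : List Bool → List Bool} (hc : OneBit c) (u : List Bool) :
    ∀ (k i₀ : ℕ) (b : Bool), foldAcc xorOp c u i₀ k [b] =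
      [xor b (Nat.bodd #((range k).filter fun i => c (boolPair u (ones (i₀ + i))) = [true]))]
  | 0, i₀, b => by simp
  | k + 1, i₀, b => by
    obtain ⟨b', hb'⟩ := hc (boolPair u (ones (i₀ + k)))
    rw [foldAcc_succ', foldAcc_xorOp hc u k i₀ b, hb', xorOp_boolPair, Finset.range_add_one,
      Finset.filter_insert]
    have hk : k ∉ (range k).filter fun i => c (boolPair u (ones (i₀ + i))) = [true] := by simp
    by_cases h : c (boolPair u (ones (i₀ + k))) = [true]
    · rw [if_pos h, Finset.card_insert_of_notMem hk, Nat.bodd_succ]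
      have hb'' : b' = true := by simpa [hb'] using h
      subst hb''
      cases b <;> cases Nat.bodd _ <;> rfl
    · rw [if_neg h]
      have hb'' : b' = false := by
        cases b'
        · rfl
        · exact absurd hb' h
      subst hb''
      cases b <;> cases Nat.bodd _ <;> rfl

/-- **The index-parity loop** `parityIdxFn h c u = [parity of #{i < |h u| | c ⟨u, 1ⁱ⟩ = [1]}]`:
`|h u|` rounds of the XOR fold of the one-bit test `c` (yardstick `h`, counter `bin |h u|`,
accumulator `[0]`). [cite: AroraBarakCC2009, §1.3 (bounded loops)] -/
def parityIdxFn (h c : List Bool → List Bool) : List Bool → List Bool :=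
  sndPow 2 ∘ foldLoop xorOp c X ∘ fanoutFn id (fanoutFn (lenBinF ∘ h) fun _ => boolPair [] [false])

/-- **`parityIdxFn h c ∈ FP`** for `h ∈ FP` and a one-bit `c ∈ FP`. [cite: AroraBarakCC2009, §1.3 (bounded loops)] -/
theorem parityIdxFn_mem_FP {h c : List Bool → List Bool} (hh : h ∈ FP) (hcFP : c ∈ FP)
    (hc : OneBit c) : parityIdxFn h c ∈ FP :=
  comp_mem_FP (sndPow_mem_FP 2)
    (comp_mem_FP
      (foldLoop_mem_FP xorOp_mem_FP length_xorOp_le hcFP (C := 1)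
        (fun w => by rw [hc.length_eq]; omega) X)
      (fanoutFn_mem_FP OracleCompose.id_mem_FP
        (fanoutFn_mem_FP (comp_mem_FP lenBinF_mem_FP hh) (const_mem_FP _))))

/-- **Value of the index-parity loop** when the yardstick fits (`|h u| ≤ |u|`). [folklore] -/
theorem parityIdxFn_apply {h c : List Bool → List Bool} (hc : OneBit c) {u : List Bool}
    (hu : (h u).length ≤ u.length) :
    parityIdxFn h c u =
      [Nat.bodd #((range (h u).length).filter fun i => c (boolPair u (ones i)) = [true])] := by
  have hinit : fanoutFn id (fanoutFn (lenBinF ∘ h) fun _ => boolPair [] [false]) u =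
      boolPair u (boolPair (encodeNat (h u).length) (boolPair (ones 0) [false])) := by
    simp [ones]
  simp only [parityIdxFn, Function.comp_apply, hinit]
  rw [foldLoop_apply xorOp c (by simpa using hu) 0 [false], sndPow_succ_boolPair,
    sndPow_succ_boolPair, sndPow_zero_boolPair, foldAcc_xorOp hc]
  simp

/-! ## Parameters of the witness language -/

/-- The block length `s(n) = min (2^{32 ⌊log₂ ⌊log₂ n⌋⌋} - 1) n + 1` (`= 2^{32 ⌊log₂ a⌋}` at
`n = 2^a`, `a ≥ 32 ⌊log₂ a⌋`). [folklore] -/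
def nmBlockLen (n : ℕ) : ℕ := min (2 ^ (32 * Nat.log 2 (Nat.log 2 n)) - 1) n + 1

/-- The number of blocks `K(n) = n / s(n)`. [folklore] -/
def nmBlocks (n : ℕ) : ℕ := n / nmBlockLen n

/-- The `j`-th block of `u`: `s(|u|)` symbols from position `j · s(|u|)`. [folklore] -/
def nmBlock (u : List Bool) (j : ℕ) : List Bool :=
  (u.drop (j * nmBlockLen u.length)).take (nmBlockLen u.length)

/-- `1 ≤ s(n)`. [folklore] -/
theorem one_le_nmBlockLen (n : ℕ) : 1 ≤ nmBlockLen n := Nat.le_add_left _ _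

/-- `K(n) ≤ n`. [folklore] -/
theorem nmBlocks_le (n : ℕ) : nmBlocks n ≤ n := Nat.div_le_self _ _

/-- The block-length brick `sFn u = 1^{s(|u|)}`. [folklore] -/
def sFn : List Bool → List Bool :=
  List.cons true ∘ binToUnaryFn ∘ fanoutFn id (polyFn (Polynomial.C 32 * X) ∘ logFn ∘ logFn)

/-- Value of `sFn`. [folklore] -/
theorem sFn_apply (u : List Bool) : sFn u = ones (nmBlockLen u.length) := by
  simp only [sFn, Function.comp_apply, fanoutFn_apply, id, polyFn_apply, eval_mul, eval_C, eval_X,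
    length_logFn, binToUnaryFn_boolPair, bitsToNat_ones, nmBlockLen]
  simp [ones, List.replicate_succ]

/-- `sFn ∈ FP`. [folklore] -/
theorem sFn_mem_FP : sFn ∈ FP :=
  comp_mem_FP (cons_mem_FP true) (comp_mem_FP binToUnaryFn_mem_FP
    (fanoutFn_mem_FP OracleCompose.id_mem_FP
      (comp_mem_FP (polyFn_mem_FP _) (comp_mem_FP logFn_mem_FP logFn_mem_FP))))

/-- The block-count brick `kFn u = 1^{K(|u|)}` (the yardstick of the parity loop). [folklore] -/
def kFn : List Bool → List Bool := fstF ∘ divModFn ∘ fanoutFn sFn (polyFn X)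

/-- Value of `kFn`. [folklore] -/
theorem kFn_apply (u : List Bool) : kFn u = ones (nmBlocks u.length) := by
  simp only [kFn, Function.comp_apply, fanoutFn_apply, sFn_apply, polyFn_apply, eval_X,
    divModFn_boolPair, fstF_boolPair, nmBlocks]

/-- `kFn ∈ FP`. [folklore] -/
theorem kFn_mem_FP : kFn ∈ FP :=
  comp_mem_FP fstF_mem_FP (comp_mem_FP divModFn_mem_FP (fanoutFn_mem_FP sFn_mem_FP (polyFn_mem_FP _)))

/-- The yardstick fits: `|kFn u| ≤ |u|`. [folklore] -/
theorem length_kFn_le (u : List Bool) : (kFn u).length ≤ u.length := by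
  rw [kFn_apply]; simpa [ones] using nmBlocks_le u.length

/-- The block-extraction brick `blkFn ⟨u, 1ʲ⟩ = nmBlock u j`. [folklore] -/
def blkFn : List Bool → List Bool :=
  takeFn ∘ fanoutFn (sFn ∘ fstF) (dropFn ∘ fanoutFn (umulFn ∘ fanoutFn sndF (sFn ∘ fstF)) fstF)

/-- Value of `blkFn` on a round word. [folklore] -/
theorem blkFn_apply (u : List Bool) (j : ℕ) : blkFn (boolPair u (ones j)) = nmBlock u j := by
  simp only [blkFn, Function.comp_apply, fanoutFn_apply, fstF_boolPair, sndF_boolPair, sFn_apply,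
    umulFn_boolPair, dropFn_boolPair, takeFn_boolPair, nmBlock]
  simp [ones]

/-- `blkFn ∈ FP`. [folklore] -/
theorem blkFn_mem_FP : blkFn ∈ FP :=
  comp_mem_FP takeFn_mem_FP (fanoutFn_mem_FP (comp_mem_FP sFn_mem_FP fstF_mem_FP)
    (comp_mem_FP dropFn_mem_FP (fanoutFn_mem_FP
      (comp_mem_FP umulFn_mem_FP (fanoutFn_mem_FP sndF_mem_FP (comp_mem_FP sFn_mem_FP fstF_mem_FP)))
      fstF_mem_FP)))

/-! ## The witness language -/

/-- **The witness language of T4**: strings an odd number of whose `K(|u|)` blocks lie in the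
Tardos witness language `witnessLang F` (the parity fold of `2^{budget}` Tardos blocks at the
designed lengths). [cite: Jukna2012, Thm. 10.21 (PDF pp. 310–311)] -/
def nearMarkovLang (F : List Bool → List Bool) : Language Bool :=
  {u | Nat.bodd #((range (nmBlocks u.length)).filter fun j =>
    (witnessLang F).boolIndicator (nmBlock u j) = true) = true}

/-- Membership in the witness language, unfolded. [folklore] -/
theorem mem_nearMarkovLang {F : List Bool → List Bool} {u : List Bool} :
    u ∈ nearMarkovLang F ↔ Nat.bodd #((range (nmBlocks u.length)).filter fun j =>
      (witnessLang F).boolIndicator (nmBlock u j) = true) = true :=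
  Iff.rfl

/-- The block test `⟨u, 1ʲ⟩ ↦ [nmBlock u j ∈ witnessLang F]` as a one-bit brick. [folklore] -/
def blkTestFn (F : List Bool → List Bool) : List Bool → List Bool :=
  Oracle.ofLanguage (witnessLang F) ∘ blkFn

/-- Value of the block test on a round word. [folklore] -/
theorem blkTestFn_apply (F : List Bool → List Bool) (u : List Bool) (j : ℕ) :
    blkTestFn F (boolPair u (ones j)) = [(witnessLang F).boolIndicator (nmBlock u j)] := by
  simp only [blkTestFn, Function.comp_apply, blkFn_apply, PRelSigma.ofLanguage_eq_singleton]

/-- The block test is one-bit. [folklore] -/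
theorem oneBit_blkTestFn (F : List Bool → List Bool) : OneBit (blkTestFn F) :=
  (GuardedBall.oneBit_ofLanguage _).comp _

/-- The block test is in `FP` when `F` is (`witnessLang F ∈ P`). [cite: AroraBarakCC2009, §1.3] -/
theorem blkTestFn_mem_FP {F : List Bool → List Bool} (hF : F ∈ FP) : blkTestFn F ∈ FP :=
  comp_mem_FP (GuardedBall.ofLanguage_mem_FP_of_mem_P (witnessLang_mem_P hF)) blkFn_mem_FP

/-- **The decider**: the index-parity loop of the block test with yardstick `kFn` computes the
defining parity of the witness language. [folklore] -/
theorem parityIdxFn_eq (F : List Bool → List Bool) (u : List Bool) :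
    parityIdxFn kFn (blkTestFn F) u = [Nat.bodd #((range (nmBlocks u.length)).filter fun j =>
      (witnessLang F).boolIndicator (nmBlock u j) = true)] := by
  rw [parityIdxFn_apply (oneBit_blkTestFn F) (length_kFn_le u), kFn_apply]
  have hlen : (ones (nmBlocks u.length)).length = nmBlocks u.length := by simp [ones]
  rw [hlen]
  have hfilter : ((range (nmBlocks u.length)).filter fun i =>
      blkTestFn F (boolPair u (ones i)) = [true]) =
      (range (nmBlocks u.length)).filter fun j =>
        (witnessLang F).boolIndicator (nmBlock u j) = true := by
    refine Finset.filter_congr fun j _ => ?_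
    rw [blkTestFn_apply]
    simp
  rw [hfilter]

/-- **The witness language is in `P`.** [cite: AroraBarakCC2009, §1.3 (bounded loops)] -/
theorem nearMarkovLang_mem_P {F : List Bool → List Bool} (hF : F ∈ FP) :
    nearMarkovLang F ∈ Classes.P := by
  refine mem_P_of_mem_FP (parityIdxFn_mem_FP kFn_mem_FP (blkTestFn_mem_FP hF) (oneBit_blkTestFn F))
    _ fun u => ⟨fun h => ?_, fun h => ?_⟩
  · rw [mem_nearMarkovLang] at h
    rw [parityIdxFn_eq, h]
  · rw [mem_nearMarkovLang, Bool.not_eq_true] at h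
    rw [parityIdxFn_eq, h]

/-- **The witness language is in `NP`** (`P ⊆ NP`). [cite: AroraBarak2009, Claim 2.4] -/
theorem nearMarkovLang_mem_NP {F : List Bool → List Bool} (hF : F ∈ FP) :
    nearMarkovLang F ∈ Nondeterministic.NP :=
  P_subset_NP_holds (nearMarkovLang_mem_P hF)

/-! ## Slices in terms of blocks -/

/-- A window of `List.ofFn`. [folklore] -/
theorem take_drop_ofFn {n a k : ℕ} (w : Fin n → Bool) (hk : a + k ≤ n) :
    ((List.ofFn w).drop a).take k = List.ofFn fun i : Fin k => w ⟨a + i, by omega⟩ := by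
  apply List.ext_getElem
  · simp; omega
  · intro i h1 h2
    simp [List.getElem_take, List.getElem_drop, List.getElem_ofFn]

/-- The `j`-th block of the input word of a slice, as a function of the block coordinates
(`j · s + i < n` for `j < K = n / s`). [folklore] -/
theorem nmBlock_ofFn {n : ℕ} (x : Fin n → Bool) {j : ℕ} (hj : j < nmBlocks n) :
    nmBlock (List.ofFn x) j = List.ofFn fun i : Fin (nmBlockLen n) =>
      x ⟨j * nmBlockLen n + i, by
        have h1 : (j + 1) * nmBlockLen n ≤ n := by
          have := Nat.div_mul_le_self n (nmBlockLen n)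
          have h2 : (j + 1) * nmBlockLen n ≤ (n / nmBlockLen n) * nmBlockLen n :=
            Nat.mul_le_mul_right _ (Nat.succ_le_of_lt hj)
          exact h2.trans this
        have h3 := i.2
        rw [Nat.succ_mul] at h1
        omega⟩ := by
  unfold nmBlock
  rw [List.length_ofFn]
  refine take_drop_ofFn x ?_
  have := Nat.div_mul_le_self n (nmBlockLen n)
  have h2 : (j + 1) * nmBlockLen n ≤ (n / nmBlockLen n) * nmBlockLen n :=
    Nat.mul_le_mul_right _ (Nat.succ_le_of_lt hj)
  rw [Nat.succ_mul] at h2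
  exact h2.trans this

/-- **The slice of the witness language at length `n`**: the parity of the number of blocks
`j < K(n)` whose block word the slice `(witnessLang F)_{s(n)}` accepts. [folklore] -/
theorem sliceFn_nearMarkovLang (F : List Bool → List Bool) {n : ℕ} (x : Fin n → Bool) :
    (nearMarkovLang F).sliceFn n x = Nat.bodd #((range (nmBlocks n)).filter fun j =>
      (witnessLang F).boolIndicator (nmBlock (List.ofFn x) j) = true) := by
  have h : List.ofFn x ∈ nearMarkovLang F ↔ Nat.bodd #((range (nmBlocks n)).filter fun j =>
      (witnessLang F).boolIndicator (nmBlock (List.ofFn x) j) = true) = true := by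
    rw [mem_nearMarkovLang, List.length_ofFn]
  show (nearMarkovLang F).boolIndicator (List.ofFn x) = _
  rw [Bool.eq_iff_iff]
  exact (Set.mem_iff_boolIndicator _ _).symm.trans h

end Summit.PneNP.PneNP.Theorems.NegLimNearMarkov

end
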